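import Summits.QuantumFields.YangMills.Theorems.UnitScaleTiltProp7TransportedBumpNorms
import HarnessLib

/-!
# Route `UnitScaleTilt`, crux K1 «MinimiserStabilityRegPr» (stmt-QuantumFields-19200), EX face — K-storey (px12 g16 LOCATE-K137), pen (K1b-a) (px13 g15; LOCATE #43 §6 (F2c, part 2)) —
# **THE TRANSPORTED INTERPOLANT `E` OF `Q_k(U₀)` ON `RegPr`: ROW (a) `‖Q_k(U₀)(E c) − c‖ ≤ θ‖c‖` AND ROW (s1) `‖E c‖ = C₁‖c‖`, GENERIC PROFILE**

Cell `ym3-torus` (HUMAN RULING D-0037; rung R3 = SU(2) YM₃ on T³ — NOT d = 4, NOT infinite volume, NOT a mass gap, NOT Clay).  Width seat `ym3-torus-px13` (gen 15).  THEOREMS ONLY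
(0 `def`, 0 `sorry`); `--supports stmt-QuantumFields-19200 --as helper`; count-neutral; nothing of Bałaban's asserted.

THE INTERPOLANT (LOCATE #43 §3; px12 g16 (K1b-a) «a K-free transported approximate right inverse of `Q_k(U₀)`»).  `E c := toL2 A_C` with the field of ✓`Prop7TransportedBumpNorms`:
`A_C(b) = ψ(b) • Ad_{(σ_{ŷ_b}(b₋)♭)⁻¹}(m̂⁻¹ • Ad_{Φ(B^k b₋)} C(e⁻¹ŷ_b))`, `C = toL2B⁻¹c`, `m̂ := OWN·T^{d−1}·((L^{d+1})^k)⁻¹` (the flat own-block mass of the separable profile `ψ = p ⊗ τ^{⊗(d−1)}`),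
per block transported by the axial cube gauge of the block corner — so that, by ✓`Prop7TransportedBumpFlatRow` and the ENGINE ✓`Prop7QkFramedFlatCubeGauge`, `Q_k(U₀)(E c) = c + SP c + Σ_ŷ err_ŷ` with
`‖SP c‖ = (SPILL∕OWN)‖c‖` (the backward neighbour's share) and `‖Σ_ŷ err_ŷ‖² ≤ 2d·ρ·(cB∕(c₀ℓ^d))·‖E c‖²` (curvature, read-set overlap `≤ 2d`).

WHAT IS PROVED (ns `…Theorems.Prop7TransportedInterpolant`; generic one-dimensional weights `p τ : ℕ → ℝ` with `OWN > 0`, `T ≠ 0`).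
* ★★★ `norm_Qk_interpolant_sub_le` — ROW (a) for the field: `‖Q_k(U₀)(toL2 A_C) − toL2B C‖ ≤ (|SPILL|∕OWN + √(2d·ρ·(cB∕(c₀ℓ^d))·c₀·m̂⁻²Ψ₂·cB⁻¹))·‖toL2B C‖` at `RegPr F n K ε₀ U₀`, `10¹⁰L⁶ε₀ ≤ 1`,
  `10¹²L³ε₀ ≤ 1`, no-wrap `2(d(ℓ−1) + 8ℓ + 1) ≤ sitesPerDir 0`, `ρ = 4(3·10¹⁰L¹⁰ε₀² + 192(ℓ·2a₀(d(ℓ−1) + 7ℓ))²)`, `Ψ₂ = (Σp²)(Στ²)^{d−1}`.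
* ★★★ `exists_transportedInterpolant` — `∃ E : WL2 →ₗ[ℂ] BondL2K`, (formula) `toL2⁻¹(E c) = A_{toL2B⁻¹c}` ∧ (a) `‖Q_k(U₀)(E c) − c‖ ≤ θ‖c‖` ∧ (s1) `‖E c‖² = (c₀m̂⁻²Ψ₂∕cB)·‖c‖²` — the letters `hQE`∕`hE₁` of
  px12 ✓`Prop7KinvBoundOfInterpolant.norm_KinvT_le_of_interpolant_rows` up to the numeric `θ ≤ ½` (the skew∕parabola instance: next file) and (s2) (F3).
HONEST SCOPE.  Rows (a), (s1) for a generic profile; `θ ≤ ½` for the skew profile, (s2), (K1b), K137, EX and the crux are NOT proved here.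

References: T. Bałaban, CMP **99** (1985) 389–434 [Balaban1985BackgroundPropagators] ((3.13)–(3.16) p.393, (3.126)–(3.132) pp.420–422); CMP **95** (1984) 17–40 [Balaban1984PropagatorsI]
((1.18) p.20, (1.47)–(1.50) p.26); CMP **98** (1985) 17–51 [Balaban1985Averaging] ((18)–(20) p.21, Prop. 4 (134)–(135) p.38).
-/

set_option autoImplicit false

noncomputable section

open scoped BigOperators Matrix.Norms.L2Operator Matrix

namespace Summit.QuantumFields.YangMills.Theorems.Prop7TransportedInterpolant

open Literature.MathematicalPhysics.QuantumFieldTheory.Balaban1983to89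
open Literature.MathematicalPhysics.QuantumFieldTheory.Balaban1983to89.T3ContinuumYM3Torus
open Finset T4Continuum BlockAveraging LatticeFieldCalculus B1RG242Torus
open B5Eq118OneStroke (iterBlockOf)
open B7Prop1Explicit (U1)
open B7Eq78Linearization (conjR conjR_apply conjR_add conjR_smul conjR_smul_real)
open B8Ineq132 (conjR_conjR one_conjR)
open B9Eq311L2Pairing (WL2)
open B10Eq27TorusAxialLog (axialT axialT_self unitsField toUField suIncl)
open B11Eq103H1Complex (BondL2K)
open B15DeterminingSets (embIter)
open T3LevelShift (bondShift)
open T3PrintedRegularOrbits (sites_eq)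
open T3PrintedRegularMinimiser (RegPr)
open T3RegularMinimiser (regThreshold regThreshold_pos)
open T3SectALandauChart (eta eta_pos)
open Summit.QuantumFields.YangMills.Theorems.Prop7SectET3Transport (periodsT3)
open Summit.QuantumFields.YangMills.Theorems.Prop7SectET3HilbertLetters (W₂ toL2 toL2B)
open Summit.QuantumFields.YangMills.Theorems.Prop7SectET3CurvedPropagators (Qk)
open Summit.QuantumFields.YangMills.Theorems.Prop7SymAvgTwSym (QTwS)
open Summit.QuantumFields.YangMills.Theorems.Prop7LaplaceAFlatLetters (norm_sq_toL2 norm_sq_toL2B)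
open Summit.QuantumFields.YangMills.Theorems.Prop7TransportedBumpFlatRow (pbond_eq_iff frameField_mem_U1 eta_smul_conjR_QTwS_one_gauged_bump_apply normSq_Qk_bump_sub_flat_le
  symm_Qk_bump_apply_eq_zero_of_not_read flat_bump_apply_eq_zero_of_not_read)
open Summit.QuantumFields.YangMills.Theorems.Prop7TransportedBumpNorms (sum_normSq_sum_le_of_support card_filter_src_or_le axialFrame_mem_U1 normSq_toL2_interpolant normSq_toL2B_spillShift
  bump_sum_apply sum_normSq_toL2_bump)

variable (F : T3Family) (n K : ℕ) (h : n ≤ K) (c₀ cB : ℝ) [Fact (0 < c₀)] [Fact (0 < cB)]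

/-- ★★★ **ROW (a) FOR THE TRANSPORTED INTERPOLANT FIELD, GENERIC PROFILE**: `RegPr F n K ε₀ U₀`, `10¹⁰L⁶ε₀ ≤ 1`, `10¹²L³ε₀ ≤ 1`, no-wrap `2(d(ℓ−1) + 8ℓ + 1) ≤ sitesPerDir 0`, weights with
`OWN = Σ_{s<ℓ}(s+1)p(s) > 0`, `T = Σ_{a<ℓ}τ(a) ≠ 0` ⟹ for every coarse datum `C`,
`‖Q_k(U₀)(toL2 A_C) − toL2B C‖ ≤ (|SPILL|∕OWN + √(2d·ρ·(cB∕(c₀ℓ^d))·(c₀·(m̂⁻²Ψ₂)·cB⁻¹)))·‖toL2B C‖` — own block exact (✓`eta_smul_conjR_QTwS_one_gauged_bump_apply`), spill an isometry times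
`SPILL∕OWN` (✓`normSq_toL2B_spillShift`), curvature per bump (✓`normSq_Qk_bump_sub_flat_le`) with read-set overlap `≤ 2d` (✓`sum_normSq_sum_le_of_support`, ✓`symm_Qk_bump_apply_eq_zero_of_not_read`)
and disjoint supports (✓`sum_normSq_toL2_bump`, ✓`normSq_toL2_interpolant`). [cite: Balaban1985BackgroundPropagators, (3.13)–(3.16) p.393, (3.132) p.422; Balaban1984PropagatorsI, (1.18) p.20, (1.47)–(1.50) p.26] -/
theorem norm_Qk_interpolant_sub_le {ε₀ : ℝ} (hε₀ : 0 < ε₀) (hε : 10 ^ 10 * (F.L : ℝ) ^ 6 * ε₀ ≤ 1) (hε12 : 10 ^ 12 * (F.L : ℝ) ^ 3 * ε₀ ≤ 1)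
    (U₀ : GaugeField (F.P K) 0 (Matrix.specialUnitaryGroup (Fin 2) ℂ)) (hreg : RegPr F n K ε₀ U₀) (p τ : ℕ → ℝ)
    (hOWN : 0 < ∑ s ∈ range ((F.P K).L ^ (K - n)), ((s : ℝ) + 1) * p s) (hT : (∑ a ∈ range ((F.P K).L ^ (K - n)), τ a) ≠ 0)
    (hwrap : 2 * ((F.P K).d * ((F.P K).L ^ (K - n) - 1) + 8 * (F.P K).L ^ (K - n) + 1) ≤ (F.P K).sitesPerDir 0)
    (C : PBond (F.P n) 0 → Matrix (Fin 2) (Fin 2) ℂ) :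
    ‖Qk F n K h c₀ cB U₀ (toL2 F K c₀ (fun b : PBond (F.P K) 0 =>
        (p ((b.src b.dir).val % (F.P K).L ^ (K - n)) * ∏ ν ∈ univ.erase b.dir, τ ((b.src ν).val % (F.P K).L ^ (K - n)))
          • conjR (Unitary.toUnits (suIncl ((axialT U₀ (Site.fibreSite 0 (K - n) (iterBlockOf (K - n) b.src) fun _ => (⟨0, pow_pos (F.P K).L_pos (K - n)⟩ : Fin ((F.P K).L ^ (K - n))))) b.src)))⁻¹
              ((((∑ s ∈ range ((F.P K).L ^ (K - n)), ((s : ℝ) + 1) * p s) * (∑ a ∈ range ((F.P K).L ^ (K - n)), τ a) ^ ((F.P K).d - 1)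
                  * ((((F.P K).L : ℝ) ^ ((F.P K).d + 1)) ^ (K - n))⁻¹)⁻¹)
                • conjR (axialT (unitsField (toUField U₀)) (Site.fibreSite 0 (K - n) (iterBlockOf (K - n) b.src) fun _ => (⟨0, pow_pos (F.P K).L_pos (K - n)⟩ : Fin ((F.P K).L ^ (K - n)))) (embIter (K - n) (iterBlockOf (K - n) b.src)))
                  (C ((bondShift (sites_eq F n K h)).symm ⟨iterBlockOf (K - n) b.src, b.dir⟩)))))
        - toL2B F n cB C‖
      ≤ (|∑ s ∈ range ((F.P K).L ^ (K - n)), ((((F.P K).L ^ (K - n) : ℕ) : ℝ) - 1 - (s : ℝ)) * p s| / (∑ s ∈ range ((F.P K).L ^ (K - n)), ((s : ℝ) + 1) * p s)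
          + Real.sqrt (2 * (F.P K).d
              * (4 * (3 * 10 ^ 10 * (F.L : ℝ) ^ 10 * ε₀ ^ 2
                  + 192 * ((F.L : ℝ) ^ (K - n) * (2 * regThreshold F n K ε₀ * (((((F.P K).d * ((F.P K).L ^ (K - n) - 1) : ℕ)) : ℝ) + 7 * (F.L : ℝ) ^ (K - n)))) ^ 2))
              * (cB / (c₀ * ((F.L : ℝ) ^ (K - n)) ^ (F.P K).d))
              * (c₀ * ((((∑ s ∈ range ((F.P K).L ^ (K - n)), ((s : ℝ) + 1) * p s) * (∑ a ∈ range ((F.P K).L ^ (K - n)), τ a) ^ ((F.P K).d - 1)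
                  * ((((F.P K).L : ℝ) ^ ((F.P K).d + 1)) ^ (K - n))⁻¹)⁻¹) ^ 2
                  * ((∑ a : Fin ((F.P K).L ^ (K - n)), p a ^ 2) * (∑ a : Fin ((F.P K).L ^ (K - n)), τ a ^ 2) ^ ((F.P K).d - 1))) * cB⁻¹)))
        * ‖toL2B F n cB C‖ := by
  classical
  have hk : K - n ≤ (F.P K).m + (F.P K).K := by show K - n ≤ F.m + K; omega
  have hcB : (0 : ℝ) < cB := Fact.out
  have hc₀ : (0 : ℝ) < c₀ := Fact.out
  have hL0 : (0 : ℝ) < (F.P K).L := by exact_mod_cast (F.P K).L_pos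
  have hs : (0 : ℝ) < (((F.P K).L : ℝ) ^ ((F.P K).d + 1)) ^ (K - n) := by positivity
  -- ABBREVIATIONS
  set ℓr : ℝ := (((F.P K).L : ℝ) ^ ((F.P K).d + 1)) ^ (K - n) with hℓr
  set OWN : ℝ := ∑ s ∈ range ((F.P K).L ^ (K - n)), ((s : ℝ) + 1) * p s with hOWNdef
  set SPILL : ℝ := ∑ s ∈ range ((F.P K).L ^ (K - n)), ((((F.P K).L ^ (K - n) : ℕ) : ℝ) - 1 - (s : ℝ)) * p s with hSPILLdef
  set T : ℝ := ∑ a ∈ range ((F.P K).L ^ (K - n)), τ a with hTdef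
  set mh : ℝ := OWN * T ^ ((F.P K).d - 1) * ℓr⁻¹ with hmh
  have hmh0 : mh ≠ 0 := by
    rw [hmh]; exact mul_ne_zero (mul_ne_zero hOWN.ne' (pow_ne_zero _ hT)) (inv_ne_zero hs.ne')
  set ρ : ℝ := 4 * (3 * 10 ^ 10 * (F.L : ℝ) ^ 10 * ε₀ ^ 2
      + 192 * ((F.L : ℝ) ^ (K - n) * (2 * regThreshold F n K ε₀ * (((((F.P K).d * ((F.P K).L ^ (K - n) - 1) : ℕ)) : ℝ) + 7 * (F.L : ℝ) ^ (K - n)))) ^ 2) with hρ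
  set r : ℝ := cB / (c₀ * ((F.L : ℝ) ^ (K - n)) ^ (F.P K).d) with hr
  set Ψ₂ : ℝ := (∑ a : Fin ((F.P K).L ^ (K - n)), p a ^ 2) * (∑ a : Fin ((F.P K).L ^ (K - n)), τ a ^ 2) ^ ((F.P K).d - 1) with hΨ₂
  have hρ0 : 0 ≤ ρ := by rw [hρ]; positivity
  have hr0 : 0 ≤ r := by rw [hr]; positivity
  have hΨ0 : 0 ≤ Ψ₂ := by rw [hΨ₂]; exact mul_nonneg (Finset.sum_nonneg fun _ _ => sq_nonneg _) (pow_nonneg (Finset.sum_nonneg fun _ _ => sq_nonneg _) _)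
  -- the coarse ↔ level-`k` dictionary
  set e := bondShift (sites_eq F n K h) with he
  -- the (iv) frame, the bump values, the bumps, their gauged copies, the frame fields, the flat readbacks
  set Φ : Site (F.P K) (K - n) → (Matrix (Fin 2) (Fin 2) ℂ)ˣ := fun z =>
    axialT (unitsField (toUField U₀)) (Site.fibreSite 0 (K - n) z fun _ => (⟨0, pow_pos (F.P K).L_pos (K - n)⟩ : Fin ((F.P K).L ^ (K - n)))) (embIter (K - n) z) with hΦ
  set V : PBond (F.P K) (K - n) → Matrix (Fin 2) (Fin 2) ℂ := fun ŷ => mh⁻¹ • conjR (Φ ŷ.src) (C (e.symm ŷ)) with hV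
  set A : PBond (F.P K) (K - n) → PBond (F.P K) 0 → Matrix (Fin 2) (Fin 2) ℂ := fun ŷ b =>
    if iterBlockOf (K - n) b.src = ŷ.src ∧ b.dir = ŷ.dir then
      (p ((b.src b.dir).val % (F.P K).L ^ (K - n)) * ∏ ν ∈ univ.erase b.dir, τ ((b.src ν).val % (F.P K).L ^ (K - n)))
        • conjR (Unitary.toUnits (suIncl ((axialT U₀ (Site.fibreSite 0 (K - n) ŷ.src fun _ => (⟨0, pow_pos (F.P K).L_pos (K - n)⟩ : Fin ((F.P K).L ^ (K - n))))) b.src)))⁻¹ (V ŷ)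
    else 0 with hA
  set w : PBond (F.P K) (K - n) → PBond (F.P n) 0 → (Matrix (Fin 2) (Fin 2) ℂ)ˣ := fun ŷ c' =>
    ((axialT (unitsField (toUField U₀)) (Site.fibreSite 0 (K - n) (e c').src fun _ => (⟨0, pow_pos (F.P K).L_pos (K - n)⟩ : Fin ((F.P K).L ^ (K - n)))) (embIter (K - n) (e c').src))⁻¹
      * (Unitary.toUnits (suIncl ((axialT U₀ (Site.fibreSite 0 (K - n) ŷ.src fun _ => (⟨0, pow_pos (F.P K).L_pos (K - n)⟩ : Fin ((F.P K).L ^ (K - n))))) (Site.fibreSite 0 (K - n) (e c').src fun _ => (⟨0, pow_pos (F.P K).L_pos (K - n)⟩ : Fin ((F.P K).L ^ (K - n)))))))⁻¹) with hw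
  set Fl : PBond (F.P K) (K - n) → WL2 ℂ (fun _ : PBond (F.P n) 0 => cB) W₂ := fun ŷ =>
    ((eta F n K : ℝ) : ℂ) • toL2B F n cB (fun c' => conjR (w ŷ c')
      (QTwS F n K h (1 : GaugeField (F.P K) 0 (Matrix.specialUnitaryGroup (Fin 2) ℂ))
        (fun b => (((axialT U₀ (Site.fibreSite 0 (K - n) ŷ.src fun _ => (⟨0, pow_pos (F.P K).L_pos (K - n)⟩ : Fin ((F.P K).L ^ (K - n))))) b.src : Matrix.specialUnitaryGroup (Fin 2) ℂ) : Matrix (Fin 2) (Fin 2) ℂ)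
          * A ŷ b
          * star (((axialT U₀ (Site.fibreSite 0 (K - n) ŷ.src fun _ => (⟨0, pow_pos (F.P K).L_pos (K - n)⟩ : Fin ((F.P K).L ^ (K - n))))) b.src : Matrix.specialUnitaryGroup (Fin 2) ℂ) : Matrix (Fin 2) (Fin 2) ℂ)) c')) with hFl
  -- the spill operator
  set SP : PBond (F.P n) 0 → Matrix (Fin 2) (Fin 2) ℂ := fun c' =>
    (SPILL / OWN) • conjR (w ⟨(e c').tgt, (e c').dir⟩ c' * Φ (e c').tgt) (C (e.symm ⟨(e c').tgt, (e c').dir⟩)) with hSP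
  -- (V1) THE FIELD IS THE SUM OF ITS BUMPS
  have hfield : (fun b : PBond (F.P K) 0 =>
        (p ((b.src b.dir).val % (F.P K).L ^ (K - n)) * ∏ ν ∈ univ.erase b.dir, τ ((b.src ν).val % (F.P K).L ^ (K - n)))
          • conjR (Unitary.toUnits (suIncl ((axialT U₀ (Site.fibreSite 0 (K - n) (iterBlockOf (K - n) b.src) fun _ => (⟨0, pow_pos (F.P K).L_pos (K - n)⟩ : Fin ((F.P K).L ^ (K - n))))) b.src)))⁻¹
              (mh⁻¹ • conjR (Φ (iterBlockOf (K - n) b.src)) (C (e.symm ⟨iterBlockOf (K - n) b.src, b.dir⟩))))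
      = ∑ ŷ : PBond (F.P K) (K - n), A ŷ := by
    funext b
    rw [Finset.sum_apply]
    exact (bump_sum_apply F n K U₀ p τ V b).symm
  have hQsum : Qk F n K h c₀ cB U₀ (toL2 F K c₀ (∑ ŷ : PBond (F.P K) (K - n), A ŷ)) = ∑ ŷ, Qk F n K h c₀ cB U₀ (toL2 F K c₀ (A ŷ)) := by
    rw [map_sum, map_sum]
  -- (V2) THE FLAT READBACKS: own block exact, backward neighbour = spill
  have hflat : ∀ (ŷ : PBond (F.P K) (K - n)) (c' : PBond (F.P n) 0), (toL2B F n cB).symm (Fl ŷ) c'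
      = (if e c' = ŷ then C (e.symm ŷ) else 0)
        + (if (e c').tgt = ŷ.src ∧ (e c').dir = ŷ.dir then (SPILL / OWN) • conjR (w ŷ c' * Φ ŷ.src) (C (e.symm ŷ)) else 0) := by
    intro ŷ c'
    have h1 := eta_smul_conjR_QTwS_one_gauged_bump_apply F n K h U₀ p τ ŷ (V ŷ) c'
    have hsymm : (toL2B F n cB).symm (Fl ŷ) c' = ((eta F n K : ℝ) : ℂ) • conjR (w ŷ c')
        (QTwS F n K h (1 : GaugeField (F.P K) 0 (Matrix.specialUnitaryGroup (Fin 2) ℂ))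
          (fun b => (((axialT U₀ (Site.fibreSite 0 (K - n) ŷ.src fun _ => (⟨0, pow_pos (F.P K).L_pos (K - n)⟩ : Fin ((F.P K).L ^ (K - n))))) b.src : Matrix.specialUnitaryGroup (Fin 2) ℂ) : Matrix (Fin 2) (Fin 2) ℂ)
            * A ŷ b
            * star (((axialT U₀ (Site.fibreSite 0 (K - n) ŷ.src fun _ => (⟨0, pow_pos (F.P K).L_pos (K - n)⟩ : Fin ((F.P K).L ^ (K - n))))) b.src : Matrix.specialUnitaryGroup (Fin 2) ℂ) : Matrix (Fin 2) (Fin 2) ℂ)) c') := by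
      simp only [hFl, LinearEquiv.map_smul, LinearEquiv.symm_apply_apply, Pi.smul_apply]
    rw [hsymm]
    refine h1.trans ?_
    congr 1
    · by_cases hc : e c' = ŷ
      · rw [if_pos hc, if_pos hc]
        show (OWN * T ^ ((F.P K).d - 1) * ℓr⁻¹) • conjR (Φ ŷ.src)⁻¹ (mh⁻¹ • conjR (Φ ŷ.src) (C (e.symm ŷ))) = C (e.symm ŷ)
        rw [conjR_smul_real, smul_smul, ← hmh, mul_inv_cancel₀ hmh0, one_smul, conjR_conjR, inv_mul_cancel, one_conjR]
      · rw [if_neg hc, if_neg hc]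
    · by_cases hc : (e c').tgt = ŷ.src ∧ (e c').dir = ŷ.dir
      · rw [if_pos hc, if_pos hc]
        show (SPILL * T ^ ((F.P K).d - 1) * ℓr⁻¹) • conjR (w ŷ c') (mh⁻¹ • conjR (Φ ŷ.src) (C (e.symm ŷ))) = (SPILL / OWN) • conjR (w ŷ c' * Φ ŷ.src) (C (e.symm ŷ))
        rw [conjR_smul_real, smul_smul, conjR_conjR]
        congr 1
        rw [hmh]; field_simp
      · rw [if_neg hc, if_neg hc]
  have hown : ∀ c' : PBond (F.P n) 0, ∑ ŷ : PBond (F.P K) (K - n), (if e c' = ŷ then C (e.symm ŷ) else 0) = C c' := by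
    intro c'
    calc ∑ ŷ : PBond (F.P K) (K - n), (if e c' = ŷ then C (e.symm ŷ) else 0)
        = (if e c' = e c' then C (e.symm (e c')) else 0) :=
          Finset.sum_eq_single (e c') (fun ŷ _ hne => if_neg fun (hc : e c' = ŷ) => hne hc.symm) (fun hc => absurd (Finset.mem_univ _) hc)
      _ = C c' := (if_pos rfl).trans (congrArg C (e.symm_apply_apply c'))
  have hspill : ∀ c' : PBond (F.P n) 0, ∑ ŷ : PBond (F.P K) (K - n),
      (if (e c').tgt = ŷ.src ∧ (e c').dir = ŷ.dir then (SPILL / OWN) • conjR (w ŷ c' * Φ ŷ.src) (C (e.symm ŷ)) else 0) = SP c' := by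
    intro c'
    rw [Finset.sum_eq_single (⟨(e c').tgt, (e c').dir⟩ : PBond (F.P K) (K - n))]
    · rw [if_pos ⟨rfl, rfl⟩]
      rfl
    · intro ŷ _ hne
      rw [if_neg]
      rintro ⟨h1, h2⟩
      exact hne ((pbond_eq_iff _ _).mpr ⟨h1.symm, h2.symm⟩)
    · intro hb; exact absurd (Finset.mem_univ _) hb
  have hFlsum : ∑ ŷ : PBond (F.P K) (K - n), Fl ŷ = toL2B F n cB C + toL2B F n cB SP := by
    apply (toL2B F n cB).symm.injective
    rw [map_add, LinearEquiv.symm_apply_apply, LinearEquiv.symm_apply_apply, map_sum]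
    funext c'
    rw [Finset.sum_apply, Pi.add_apply, Finset.sum_congr rfl fun ŷ _ => hflat ŷ c', Finset.sum_add_distrib, hown c', hspill c']
  -- (V3) THE SPILL OPERATOR IS `SPILL∕OWN` TIMES AN ISOMETRY
  have hSPnorm : ‖toL2B F n cB SP‖ ^ 2 = (SPILL / OWN) ^ 2 * ‖toL2B F n cB C‖ ^ 2 := by
    have hu : ∀ c' : PBond (F.P n) 0, w ⟨(e c').tgt, (e c').dir⟩ c' * Φ (e c').tgt ∈ U1 (Matrix (Fin 2) (Fin 2) ℂ) := fun c' =>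
      (U1 _).mul_mem (frameField_mem_U1 F n K h U₀ ⟨(e c').tgt, (e c').dir⟩ c') (axialFrame_mem_U1 F K U₀ _ _)
    exact normSq_toL2B_spillShift F n K h cB hu (SPILL / OWN) C
  -- (V4) THE CURVATURE ERRORS: per bump (ENGINE), read-set overlap ≤ 2d, disjoint supports
  have herr : ∀ ŷ : PBond (F.P K) (K - n), ‖Qk F n K h c₀ cB U₀ (toL2 F K c₀ (A ŷ)) - Fl ŷ‖ ^ 2 ≤ ρ * r * ‖toL2 F K c₀ (A ŷ)‖ ^ 2 := fun ŷ =>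
    normSq_Qk_bump_sub_flat_le F n K h c₀ cB hε₀ hε hε12 U₀ hreg p τ ŷ (V ŷ) hwrap
  have hloc : ∀ (c' : PBond (F.P n) 0) (ŷ : PBond (F.P K) (K - n)), ŷ ∉ univ.filter (fun ŷ : PBond (F.P K) (K - n) => ŷ.src = (e c').src ∨ ŷ.src = (e c').tgt) →
      (toL2B F n cB).symm (Qk F n K h c₀ cB U₀ (toL2 F K c₀ (A ŷ)) - Fl ŷ) c' = 0 := by
    intro c' ŷ hŷ
    have hfar : ¬ (ŷ.src = (e c').src ∨ ŷ.src = (e c').tgt) := fun hh => hŷ (Finset.mem_filter.mpr ⟨Finset.mem_univ _, hh⟩)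
    rw [map_sub, Pi.sub_apply, symm_Qk_bump_apply_eq_zero_of_not_read F n K h c₀ cB hε₀ hε12 U₀ hreg p τ ŷ (V ŷ) c' hfar, hflat ŷ c',
      if_neg (fun hc => hfar (Or.inl (by rw [← hc]))), if_neg (fun hc => hfar (Or.inr hc.1.symm)), add_zero, sub_zero]
  have hsumErr : ‖∑ ŷ : PBond (F.P K) (K - n), (Qk F n K h c₀ cB U₀ (toL2 F K c₀ (A ŷ)) - Fl ŷ)‖ ^ 2
      ≤ (2 * (F.P K).d : ℝ) * ∑ ŷ : PBond (F.P K) (K - n), ‖Qk F n K h c₀ cB U₀ (toL2 F K c₀ (A ŷ)) - Fl ŷ‖ ^ 2 := by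
    -- write every error through its coarse entries
    have hentry : ∀ v : WL2 ℂ (fun _ : PBond (F.P n) 0 => cB) W₂, ‖v‖ ^ 2 = cB * ∑ c' : PBond (F.P n) 0, ∑ i, ∑ j, ‖(toL2B F n cB).symm v c' i j‖ ^ 2 := by
      intro v
      conv_lhs => rw [← (toL2B F n cB).apply_symm_apply v]
      exact norm_sq_toL2B ((toL2B F n cB).symm v)
    rw [hentry]
    simp only [hentry]
    rw [map_sum]
    have hov := sum_normSq_sum_le_of_support (fun (ŷ : PBond (F.P K) (K - n)) (c' : PBond (F.P n) 0) => (toL2B F n cB).symm (Qk F n K h c₀ cB U₀ (toL2 F K c₀ (A ŷ)) - Fl ŷ) c')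
      (fun c' => univ.filter (fun ŷ : PBond (F.P K) (K - n) => ŷ.src = (e c').src ∨ ŷ.src = (e c').tgt)) (2 * (F.P K).d)
      (fun c' ŷ hŷ => hloc c' ŷ hŷ) (fun c' => card_filter_src_or_le _ _)
    have hsw : ∀ c' : PBond (F.P n) 0, (∑ ŷ : PBond (F.P K) (K - n), (toL2B F n cB).symm (Qk F n K h c₀ cB U₀ (toL2 F K c₀ (A ŷ)) - Fl ŷ)) c'
        = ∑ ŷ : PBond (F.P K) (K - n), (toL2B F n cB).symm (Qk F n K h c₀ cB U₀ (toL2 F K c₀ (A ŷ)) - Fl ŷ) c' := fun c' => Finset.sum_apply _ _ _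
    simp only [hsw]
    calc cB * ∑ c' : PBond (F.P n) 0, ∑ i, ∑ j, ‖(∑ ŷ : PBond (F.P K) (K - n), (toL2B F n cB).symm (Qk F n K h c₀ cB U₀ (toL2 F K c₀ (A ŷ)) - Fl ŷ) c') i j‖ ^ 2
        ≤ cB * (((2 * (F.P K).d : ℕ) : ℝ) * ∑ ŷ : PBond (F.P K) (K - n), ∑ c' : PBond (F.P n) 0, ∑ i, ∑ j, ‖(toL2B F n cB).symm (Qk F n K h c₀ cB U₀ (toL2 F K c₀ (A ŷ)) - Fl ŷ) c' i j‖ ^ 2) :=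
          mul_le_mul_of_nonneg_left hov hcB.le
      _ = (2 * (F.P K).d : ℝ) * ∑ ŷ : PBond (F.P K) (K - n), (cB * ∑ c' : PBond (F.P n) 0, ∑ i, ∑ j, ‖(toL2B F n cB).symm (Qk F n K h c₀ cB U₀ (toL2 F K c₀ (A ŷ)) - Fl ŷ) c' i j‖ ^ 2) := by
          rw [← Finset.mul_sum]; push_cast; ring
  have hErr2 : ‖∑ ŷ : PBond (F.P K) (K - n), (Qk F n K h c₀ cB U₀ (toL2 F K c₀ (A ŷ)) - Fl ŷ)‖ ^ 2
      ≤ (2 * (F.P K).d : ℝ) * (ρ * r * (c₀ * (mh⁻¹ ^ 2 * Ψ₂) * (cB⁻¹ * ‖toL2B F n cB C‖ ^ 2))) := by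
    refine hsumErr.trans (mul_le_mul_of_nonneg_left ?_ (by positivity))
    calc ∑ ŷ : PBond (F.P K) (K - n), ‖Qk F n K h c₀ cB U₀ (toL2 F K c₀ (A ŷ)) - Fl ŷ‖ ^ 2
        ≤ ∑ ŷ : PBond (F.P K) (K - n), ρ * r * ‖toL2 F K c₀ (A ŷ)‖ ^ 2 := Finset.sum_le_sum fun ŷ _ => herr ŷ
      _ = ρ * r * ∑ ŷ : PBond (F.P K) (K - n), ‖toL2 F K c₀ (A ŷ)‖ ^ 2 := by rw [Finset.mul_sum]
      _ = ρ * r * (c₀ * (mh⁻¹ ^ 2 * Ψ₂) * (cB⁻¹ * ‖toL2B F n cB C‖ ^ 2)) := by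
          have hEn : ∑ ŷ : PBond (F.P K) (K - n), ‖toL2 F K c₀ (A ŷ)‖ ^ 2 = c₀ * (mh⁻¹ ^ 2 * Ψ₂) * (cB⁻¹ * ‖toL2B F n cB C‖ ^ 2) :=
            (sum_normSq_toL2_bump F n K c₀ U₀ p τ V).trans (normSq_toL2_interpolant F n K h c₀ cB U₀ p τ mh⁻¹ C)
          rw [hEn]
  -- (V5) ASSEMBLY
  have hdec : Qk F n K h c₀ cB U₀ (toL2 F K c₀ (∑ ŷ : PBond (F.P K) (K - n), A ŷ)) - toL2B F n cB C
      = toL2B F n cB SP + ∑ ŷ : PBond (F.P K) (K - n), (Qk F n K h c₀ cB U₀ (toL2 F K c₀ (A ŷ)) - Fl ŷ) := by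
    rw [hQsum, Finset.sum_sub_distrib, hFlsum]; abel
  rw [hfield, hdec]
  have hSP' : ‖toL2B F n cB SP‖ = |SPILL| / OWN * ‖toL2B F n cB C‖ := by
    have h2 : ‖toL2B F n cB SP‖ ^ 2 = (|SPILL| / OWN * ‖toL2B F n cB C‖) ^ 2 := by
      rw [hSPnorm, mul_pow, div_pow, div_pow, sq_abs]
    exact (sq_eq_sq₀ (norm_nonneg _) (mul_nonneg (div_nonneg (abs_nonneg _) hOWN.le) (norm_nonneg _))).mp h2
  have hErr' : ‖∑ ŷ : PBond (F.P K) (K - n), (Qk F n K h c₀ cB U₀ (toL2 F K c₀ (A ŷ)) - Fl ŷ)‖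
      ≤ Real.sqrt (2 * (F.P K).d * ρ * r * (c₀ * (mh⁻¹ ^ 2 * Ψ₂) * cB⁻¹)) * ‖toL2B F n cB C‖ := by
    have hx : 0 ≤ 2 * (F.P K).d * ρ * r * (c₀ * (mh⁻¹ ^ 2 * Ψ₂) * cB⁻¹) := by positivity
    rw [← Real.sqrt_sq (norm_nonneg (toL2B F n cB C)), ← Real.sqrt_mul hx, ← Real.sqrt_sq (norm_nonneg (∑ ŷ : PBond (F.P K) (K - n), _))]
    exact Real.sqrt_le_sqrt (hErr2.trans (le_of_eq (by ring)))
  calc ‖toL2B F n cB SP + ∑ ŷ : PBond (F.P K) (K - n), (Qk F n K h c₀ cB U₀ (toL2 F K c₀ (A ŷ)) - Fl ŷ)‖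
      ≤ ‖toL2B F n cB SP‖ + ‖∑ ŷ : PBond (F.P K) (K - n), (Qk F n K h c₀ cB U₀ (toL2 F K c₀ (A ŷ)) - Fl ŷ)‖ := norm_add_le _ _
    _ ≤ |SPILL| / OWN * ‖toL2B F n cB C‖ + Real.sqrt (2 * (F.P K).d * ρ * r * (c₀ * (mh⁻¹ ^ 2 * Ψ₂) * cB⁻¹)) * ‖toL2B F n cB C‖ := by rw [hSP']; exact add_le_add le_rfl hErr'
    _ = (|SPILL| / OWN + Real.sqrt (2 * (F.P K).d * ρ * r * (c₀ * (mh⁻¹ ^ 2 * Ψ₂) * cB⁻¹))) * ‖toL2B F n cB C‖ := by ring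

/-- ★★★ **THE TRANSPORTED INTERPOLANT AS A LINEAR MAP, WITH ITS ROWS (a) AND (s1)** (px12 g16 (K1b-a); the letters `E`, `hQE`, `hE₁` of ✓`Prop7KinvBoundOfInterpolant.norm_KinvT_le_of_interpolant_rows`
up to the numeric `θ ≤ ½`): `RegPr F n K ε₀ U₀`, the two windows, no-wrap, `OWN > 0`, `T ≠ 0` ⟹ `∃ E : WL2 →ₗ[ℂ] BondL2K` with (formula) `toL2⁻¹(E c) = A_{toL2B⁻¹c}` (for (s2), F3),
(a) `‖Q_k(U₀)(E c) − c‖ ≤ (|SPILL|∕OWN + √(2d·ρ·(cB∕(c₀ℓ^d))·c₀m̂⁻²Ψ₂cB⁻¹))·‖c‖`, (s1) `‖E c‖² = c₀·m̂⁻²Ψ₂·cB⁻¹·‖c‖²` (`E := toL2 ∘ A ∘ toL2B⁻¹`, ★★★`norm_Qk_interpolant_sub_le`,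
✓`normSq_toL2_interpolant`). [cite: Balaban1985BackgroundPropagators, (3.13)–(3.16) p.393, (3.126)–(3.132) pp.420–422; Balaban1984PropagatorsI, (1.47)–(1.50) p.26] -/
theorem exists_transportedInterpolant {ε₀ : ℝ} (hε₀ : 0 < ε₀) (hε : 10 ^ 10 * (F.L : ℝ) ^ 6 * ε₀ ≤ 1) (hε12 : 10 ^ 12 * (F.L : ℝ) ^ 3 * ε₀ ≤ 1)
    (U₀ : GaugeField (F.P K) 0 (Matrix.specialUnitaryGroup (Fin 2) ℂ)) (hreg : RegPr F n K ε₀ U₀) (p τ : ℕ → ℝ)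
    (hOWN : 0 < ∑ s ∈ range ((F.P K).L ^ (K - n)), ((s : ℝ) + 1) * p s) (hT : (∑ a ∈ range ((F.P K).L ^ (K - n)), τ a) ≠ 0)
    (hwrap : 2 * ((F.P K).d * ((F.P K).L ^ (K - n) - 1) + 8 * (F.P K).L ^ (K - n) + 1) ≤ (F.P K).sitesPerDir 0) :
    ∃ E : WL2 ℂ (fun _ : PBond (F.P n) 0 => cB) W₂ →ₗ[ℂ] BondL2K ℂ 3 (periodsT3 F K) c₀ W₂,
      (∀ (c : WL2 ℂ (fun _ : PBond (F.P n) 0 => cB) W₂) (b : PBond (F.P K) 0), (toL2 F K c₀).symm (E c) b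
          = (fun b : PBond (F.P K) 0 =>
        (p ((b.src b.dir).val % (F.P K).L ^ (K - n)) * ∏ ν ∈ univ.erase b.dir, τ ((b.src ν).val % (F.P K).L ^ (K - n)))
          • conjR (Unitary.toUnits (suIncl ((axialT U₀ (Site.fibreSite 0 (K - n) (iterBlockOf (K - n) b.src) fun _ => (⟨0, pow_pos (F.P K).L_pos (K - n)⟩ : Fin ((F.P K).L ^ (K - n))))) b.src)))⁻¹
              ((((∑ s ∈ range ((F.P K).L ^ (K - n)), ((s : ℝ) + 1) * p s) * (∑ a ∈ range ((F.P K).L ^ (K - n)), τ a) ^ ((F.P K).d - 1)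
                  * ((((F.P K).L : ℝ) ^ ((F.P K).d + 1)) ^ (K - n))⁻¹)⁻¹)
                • conjR (axialT (unitsField (toUField U₀)) (Site.fibreSite 0 (K - n) (iterBlockOf (K - n) b.src) fun _ => (⟨0, pow_pos (F.P K).L_pos (K - n)⟩ : Fin ((F.P K).L ^ (K - n)))) (embIter (K - n) (iterBlockOf (K - n) b.src)))
                  ((toL2B F n cB).symm c ((bondShift (sites_eq F n K h)).symm ⟨iterBlockOf (K - n) b.src, b.dir⟩)))) b)
      ∧ (∀ c : WL2 ℂ (fun _ : PBond (F.P n) 0 => cB) W₂, ‖Qk F n K h c₀ cB U₀ (E c) - c‖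
          ≤ (|∑ s ∈ range ((F.P K).L ^ (K - n)), ((((F.P K).L ^ (K - n) : ℕ) : ℝ) - 1 - (s : ℝ)) * p s| / (∑ s ∈ range ((F.P K).L ^ (K - n)), ((s : ℝ) + 1) * p s)
          + Real.sqrt (2 * (F.P K).d
              * (4 * (3 * 10 ^ 10 * (F.L : ℝ) ^ 10 * ε₀ ^ 2
                  + 192 * ((F.L : ℝ) ^ (K - n) * (2 * regThreshold F n K ε₀ * (((((F.P K).d * ((F.P K).L ^ (K - n) - 1) : ℕ)) : ℝ) + 7 * (F.L : ℝ) ^ (K - n)))) ^ 2))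
              * (cB / (c₀ * ((F.L : ℝ) ^ (K - n)) ^ (F.P K).d))
              * (c₀ * ((((∑ s ∈ range ((F.P K).L ^ (K - n)), ((s : ℝ) + 1) * p s) * (∑ a ∈ range ((F.P K).L ^ (K - n)), τ a) ^ ((F.P K).d - 1)
                  * ((((F.P K).L : ℝ) ^ ((F.P K).d + 1)) ^ (K - n))⁻¹)⁻¹) ^ 2
                  * ((∑ a : Fin ((F.P K).L ^ (K - n)), p a ^ 2) * (∑ a : Fin ((F.P K).L ^ (K - n)), τ a ^ 2) ^ ((F.P K).d - 1))) * cB⁻¹)))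
            * ‖c‖)
      ∧ (∀ c : WL2 ℂ (fun _ : PBond (F.P n) 0 => cB) W₂, ‖E c‖ ^ 2
          = c₀ * ((((∑ s ∈ range ((F.P K).L ^ (K - n)), ((s : ℝ) + 1) * p s) * (∑ a ∈ range ((F.P K).L ^ (K - n)), τ a) ^ ((F.P K).d - 1)
                  * ((((F.P K).L : ℝ) ^ ((F.P K).d + 1)) ^ (K - n))⁻¹)⁻¹) ^ 2
              * ((∑ a : Fin ((F.P K).L ^ (K - n)), p a ^ 2) * (∑ a : Fin ((F.P K).L ^ (K - n)), τ a ^ 2) ^ ((F.P K).d - 1)))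
            * (cB⁻¹ * ‖c‖ ^ 2)) := by
  classical
  -- the interpolant field as a function of the coarse datum
  let Afun : (PBond (F.P n) 0 → Matrix (Fin 2) (Fin 2) ℂ) → (PBond (F.P K) 0 → Matrix (Fin 2) (Fin 2) ℂ) := fun C =>
    (fun b : PBond (F.P K) 0 =>
        (p ((b.src b.dir).val % (F.P K).L ^ (K - n)) * ∏ ν ∈ univ.erase b.dir, τ ((b.src ν).val % (F.P K).L ^ (K - n)))
          • conjR (Unitary.toUnits (suIncl ((axialT U₀ (Site.fibreSite 0 (K - n) (iterBlockOf (K - n) b.src) fun _ => (⟨0, pow_pos (F.P K).L_pos (K - n)⟩ : Fin ((F.P K).L ^ (K - n))))) b.src)))⁻¹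
              ((((∑ s ∈ range ((F.P K).L ^ (K - n)), ((s : ℝ) + 1) * p s) * (∑ a ∈ range ((F.P K).L ^ (K - n)), τ a) ^ ((F.P K).d - 1)
                  * ((((F.P K).L : ℝ) ^ ((F.P K).d + 1)) ^ (K - n))⁻¹)⁻¹)
                • conjR (axialT (unitsField (toUField U₀)) (Site.fibreSite 0 (K - n) (iterBlockOf (K - n) b.src) fun _ => (⟨0, pow_pos (F.P K).L_pos (K - n)⟩ : Fin ((F.P K).L ^ (K - n)))) (embIter (K - n) (iterBlockOf (K - n) b.src)))
                  (C ((bondShift (sites_eq F n K h)).symm ⟨iterBlockOf (K - n) b.src, b.dir⟩))))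
  have hadd : ∀ C C' : PBond (F.P n) 0 → Matrix (Fin 2) (Fin 2) ℂ, Afun (C + C') = Afun C + Afun C' := by
    intro C C'
    funext b
    simp only [Afun, Pi.add_apply, conjR_add, smul_add]
  have hsmul : ∀ (a : ℂ) (C : PBond (F.P n) 0 → Matrix (Fin 2) (Fin 2) ℂ), Afun (a • C) = a • Afun C := by
    intro a C
    funext b
    simp only [Afun, Pi.smul_apply, conjR_smul, smul_comm (M := ℝ) (N := ℂ)]
  let Alin : (PBond (F.P n) 0 → Matrix (Fin 2) (Fin 2) ℂ) →ₗ[ℂ] (PBond (F.P K) 0 → Matrix (Fin 2) (Fin 2) ℂ) :=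
    { toFun := Afun, map_add' := hadd, map_smul' := hsmul }
  let E : WL2 ℂ (fun _ : PBond (F.P n) 0 => cB) W₂ →ₗ[ℂ] BondL2K ℂ 3 (periodsT3 F K) c₀ W₂ :=
    (toL2 F K c₀).toLinearMap ∘ₗ Alin ∘ₗ (toL2B F n cB).symm.toLinearMap
  have hE : ∀ c, E c = toL2 F K c₀ (Afun ((toL2B F n cB).symm c)) := fun c => rfl
  refine ⟨E, fun c b => ?_, fun c => ?_, fun c => ?_⟩
  · rw [hE, LinearEquiv.symm_apply_apply]
  · have hrow := norm_Qk_interpolant_sub_le F n K h c₀ cB hε₀ hε hε12 U₀ hreg p τ hOWN hT hwrap ((toL2B F n cB).symm c)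
    rw [LinearEquiv.apply_symm_apply] at hrow
    rw [hE]
    exact hrow
  · have hs1 := normSq_toL2_interpolant F n K h c₀ cB U₀ p τ
      (((∑ s ∈ range ((F.P K).L ^ (K - n)), ((s : ℝ) + 1) * p s) * (∑ a ∈ range ((F.P K).L ^ (K - n)), τ a) ^ ((F.P K).d - 1)
                  * ((((F.P K).L : ℝ) ^ ((F.P K).d + 1)) ^ (K - n))⁻¹)⁻¹)
      ((toL2B F n cB).symm c)
    rw [LinearEquiv.apply_symm_apply] at hs1
    rw [hE]
    exact hs1

end Summit.QuantumFields.YangMills.Theorems.Prop7TransportedInterpolant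

end
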